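import Summits.SmoothPoincare4.SmoothPoincare4.Theorems.ConvexBisectionAcyclicBisectionExistsSeamFibreMap
import Summits.SmoothPoincare4.SmoothPoincare4.Theorems.ConvexBisectionAcyclicBisectionExistsSeamShadowLinear
import Summits.SmoothPoincare4.SmoothPoincare4.Theorems.ConvexBisectionAcyclicBisectionExistsSeamStraightenFlow
import Summits.SmoothPoincare4.SmoothPoincare4.Theorems.ConvexBisectionAcyclicBisectionExistsPageInvariance
import HarnessLib

/-!
# Seam transport, ST3b: at a non-critical direction the shadow transport is an AUTOMORPHISM of `ℤ^{2g}`
(wave 4, brick ST3b of sub-node ST3 `node_ST3_shadowTransport` of node T3c-2 `node_seam_transport`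
of stub `stub_steinRealisation` = NF6, line `modp-braid-orbits` r11, crux
`ConvexBisection.AcyclicBisectionExists`, item stmt-SmoothPoincare4-10508; registered sub-goal
`helper_seam_shadowEquiv`)

For the data `(h, D, bX, Ψ)` of a fibred model (Lefschetz link, page clause) and a unit direction
`c` different from all critical directions `pageDir |l| k`: the `ℤ`-linear map `A_c` of
`…SeamShadowLinear.lean` (`shadow (push K) = A_c (shadow K)` for page loops `K ⊂ page g c`) is
BIJECTIVE.  Its inverse is the analogous linear map `A'_c` of the inverse seam map `F⁻¹` of
`…SeamFibreMap.lean` restricted to the page (`exists_shadowLinear_of_continuous`), and the two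
identities `A' ∘ A = id`, `A ∘ A' = id` are proved on page loops of prescribed shadow
(`exists_pageLoop_shadow_eq`, Z6-2) by STRAIGHTENING the pushed loop back into the flat page inside
its extended page (`helper_strFlow_page`, ST2), where the inverse map is defined and continuous, and
reading the composite `F⁻¹ ∘ R_t ∘ F ∘ L` (resp. `F ∘ R_t ∘ F⁻¹ ∘ L`) as a free homotopy in `Base g`
(`shadow_eq_of_family`, `shadow_comp_ambientIsotopy`).

Everything is proved; no named facts, no `sorry`, no new definitions.  References: R. İ. Baykur,
*Kähler decomposition of 4-manifolds*, AGT 6 (2006), proof of Thm. 5.1 [Baykur2006]; A. Hatcher,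
*Algebraic Topology* (2002), Thm. 2A.1 [HatcherAT2002].
-/

noncomputable section

set_option linter.dupNamespace false

open scoped Manifold ContDiff Topology

namespace Summit.SmoothPoincare4.SmoothPoincare4.Theorems.AcyclicBisectionExists.ModpBraidOrbits

open Set Function Filter Metric Topology
open Literature.Topology.FourManifolds Literature.Topology.FourManifolds.HandleAttachingMap
  Literature.Topology.FourManifolds.LefschetzBase Literature.AlgebraicTopology.SingularHomology

/-! ## §1 Two generic tools -/

/-- **The shadow of the images of page loops under ANY continuous map of the page into the base is
linear in the shadow** (`A := shadowMap ∘ F_* ∘ (shadowMap ∘ incl_*)⁻¹`). [cite: HatcherAT2002, Thm. 2A.1] -/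
theorem exists_shadowLinear_of_continuous {g : ℕ} {c : ℂ} (hc : ‖c‖ = 1)
    (Fp : ↥(page g c) → Base g) (hFp : Continuous Fp) :
    ∃ A : (Fin g ⊕ Fin g → ℤ) →ₗ[ℤ] (Fin g ⊕ Fin g → ℤ),
      ∀ (K : sphere (0 : EuclideanSpace ℝ (Fin 2)) 1 → Base g) (hK : Continuous K)
        (hKp : ∀ θ, K θ ∈ page g c),
        shadow g (fun θ => Fp ⟨K θ, hKp θ⟩) (hFp.comp (hK.subtype_mk hKp)) = A (shadow g K hK) := by
  set i : C(↥(page g c), Base g) := ⟨Subtype.val, continuous_subtype_val⟩ with hi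
  set F : C(↥(page g c), Base g) := ⟨Fp, hFp⟩ with hF
  have hbij : Function.Bijective ((shadowMap g).comp (singularHomology.map ℤ ℤ i 1).hom) :=
    bijective_shadowMap_map_pageIncl g hc
  set e : singularHomology ℤ ℤ ↥(page g c) 1 ≃ₗ[ℤ] (Fin g ⊕ Fin g → ℤ) :=
    LinearEquiv.ofBijective ((shadowMap g).comp (singularHomology.map ℤ ℤ i 1).hom) hbij with he
  refine ⟨(shadowMap g).comp ((singularHomology.map ℤ ℤ F 1).hom.comp e.symm.toLinearMap),
    fun K hK hKp => ?_⟩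
  have hx : e (loopClass ℤ ℤ (1 : ℤ) (loopPath (fun θ => (⟨K θ, hKp θ⟩ : ↥(page g c)))
      (hK.subtype_mk hKp))) = shadow g K hK := by
    rw [shadow_eq_shadowMap_map_pageIncl hK hKp]
    rfl
  have hx' : e.symm (shadow g K hK) = loopClass ℤ ℤ (1 : ℤ)
      (loopPath (fun θ => (⟨K θ, hKp θ⟩ : ↥(page g c))) (hK.subtype_mk hKp)) := by
    rw [← hx, LinearEquiv.symm_apply_apply]
  have hpath : loopPath (fun θ => Fp ⟨K θ, hKp θ⟩) (hFp.comp (hK.subtype_mk hKp)) =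
      (loopPath (fun θ => (⟨K θ, hKp θ⟩ : ↥(page g c))) (hK.subtype_mk hKp)).map F.continuous := by
    ext s; rfl
  have hmap : (singularHomology.map ℤ ℤ F 1).hom (loopClass ℤ ℤ (1 : ℤ)
      (loopPath (fun θ => (⟨K θ, hKp θ⟩ : ↥(page g c))) (hK.subtype_mk hKp))) =
      loopClass ℤ ℤ (1 : ℤ) ((loopPath (fun θ => (⟨K θ, hKp θ⟩ : ↥(page g c)))
        (hK.subtype_mk hKp)).map F.continuous) :=
    map_loopClass ℤ ℤ (1 : ℤ) _ F
  show shadowMap g (loopClass ℤ ℤ (1 : ℤ) (loopPath _ _)) =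
    shadowMap g ((singularHomology.map ℤ ℤ F 1).hom (e.symm (shadow g K hK)))
  rw [hx', hmap, hpath]

/-- A continuous positive function on the circle is bounded below by a positive constant. [folklore] -/
theorem exists_margin₁ (f : sphere (0 : EuclideanSpace ℝ (Fin 2)) 1 → ℝ) (hf : Continuous f)
    (hpos : ∀ θ, 0 < f θ) : ∃ m : ℝ, 0 < m ∧ ∀ θ, m ≤ f θ := by
  obtain ⟨θ₀, -, h⟩ := isCompact_univ.exists_isMinOn ⟨circlePt 0, mem_univ _⟩ hf.continuousOn
  exact ⟨f θ₀, hpos θ₀, fun θ => h (mem_univ θ)⟩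

/-! ## §2 The automorphism -/

section Equiv

variable {g : ℕ} {l : List ((Fin g ⊕ Fin g → ℤ) × Bool)}
  {h : Fin l.length → HandleAttachingMap 3 2 (Base g)}
  {X : Type} [TopologicalSpace X] [T2Space X] [SecondCountableTopology X] [CompactSpace X]
  [ChartedSpace (EuclideanHalfSpace 4) X] [IsManifold (𝓡∂ 4) ∞ X]
  (D : MultiAttachmentData h (𝓡∂ 4) X) (bX : BoundaryData (𝓡∂ 4) X (𝓡 3))
  (Ψ : bX.carrier ≃ₘ⟮𝓡 3, 𝓡 3⟯ (bBase g).carrier)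

omit [T2Space X] [SecondCountableTopology X] [CompactSpace X] [IsManifold (𝓡∂ 4) ∞ X] in
/-- **Points on a non-critical ray are off the cores**: the cores lie in the critical pages
`page g (pageDir |l| k)`, where `w = pageDir k / 2`. [folklore] -/
theorem mem_coresComplement_of_ray (hlink : IsLefschetzLink g l h) {c : ℂ} (hc : ‖c‖ = 1)
    (hcrit : ∀ k : Fin l.length, c ≠ pageDir l.length k) {a : Base g}
    (hray : ∃ r : ℝ, 0 < r ∧ w g a.1 = (r : ℂ) * c) : a ∈ coresComplement h := by
  rw [mem_coresComplement]
  intro k hk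
  rw [← range_attachingCircle] at hk
  obtain ⟨θ, hθ⟩ := hk
  obtain ⟨r, hr, hw⟩ := hray
  have h1 : w g a.1 = pageDir l.length k / 2 := by rw [← hθ]; exact (hlink.mem_page k θ).2
  have e : (r : ℂ) * c = ((1 / 2 : ℝ) : ℂ) * pageDir l.length k := by
    rw [← hw, h1]; push_cast; ring
  have hn : r = 1 / 2 := by
    have h2 := congrArg norm e
    rw [norm_mul, norm_mul, Complex.norm_real, Complex.norm_real, Real.norm_eq_abs, Real.norm_eq_abs,
      abs_of_pos hr, abs_of_pos (by norm_num : (0 : ℝ) < 1 / 2), hc, norm_pageDir, mul_one, mul_one] at h2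
    exact h2
  rw [hn] at e
  exact hcrit k (mul_left_cancel₀ (by norm_num) e)

/-- **ST3b — at a non-critical unit direction the shadow transport of the seam is an automorphism of
`ℤ^{2g}`**: there is `A : ℤ^{2g} ≃ₗ[ℤ] ℤ^{2g}` with `shadow (θ ↦ (bBase g).incl (Ψ (z θ))) = A (shadow K)`
for every page loop `K ⊂ page g c` with lifts `z` (`bX.incl (z θ) = D.jA (K θ)`).
[cite: Baykur2006, Thm. 5.1 (proof, p. 13)] -/
theorem seam_shadowEquiv (hlink : IsLefschetzLink g l h)
    (hpage : ∀ (y : bX.carrier) (a : ↥(coresComplement h)), bX.incl y = D.jA a →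
      ∃ c : ℝ, 0 < c ∧ w g ((bBase g).incl (Ψ y)).1 = (c : ℂ) * w g (a : Base g).1)
    {c : ℂ} (hc : ‖c‖ = 1) (hcrit : ∀ k : Fin l.length, c ≠ pageDir l.length k) :
    ∃ A : (Fin g ⊕ Fin g → ℤ) ≃ₗ[ℤ] (Fin g ⊕ Fin g → ℤ),
      ∀ (K : sphere (0 : EuclideanSpace ℝ (Fin 2)) 1 → Base g) (hKc : Continuous K)
        (hK : ∀ θ, K θ ∈ coresComplement h) (_ : ∀ θ, K θ ∈ page g c)
        (z : sphere (0 : EuclideanSpace ℝ (Fin 2)) 1 → bX.carrier)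
        (_ : ∀ θ, bX.incl (z θ) = D.jA ⟨K θ, hK θ⟩)
        (hGz : Continuous fun θ => ((bBase g).incl (Ψ (z θ)) : Base g)),
        shadow g (fun θ => ((bBase g).incl (Ψ (z θ)) : Base g)) hGz = A (shadow g K hKc) := by
  -- page points lie on the ray of direction `c`, hence off the cores and (being boundary points) in `V`
  have hpray : ∀ a ∈ page g c, ∃ r : ℝ, 0 < r ∧ w g a.1 = (r : ℂ) * c := fun a ha =>
    ⟨1 / 2, by norm_num, by rw [ha.2]; push_cast; ring⟩
  have hfree : ∀ a ∈ page g c, a ∈ coresComplement h := fun a ha =>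
    mem_coresComplement_of_ray hlink hc hcrit (hpray a ha)
  -- the seam map and its inverse
  obtain ⟨F, Finv, V, hF, hFinv, hV, hFV, hFinvU, hleft, hright, hnode, hangle, -, hrayV⟩ :=
    seam_fibreMap_of_link D bX Ψ hlink hpage
  have hpageV : ∀ a ∈ page g c, a ∈ V := fun a ha =>
    hrayV a c hc hcrit (page_subset_boundary g hc ha) (hpray a ha)
  -- the forward linear map (with lifts) and the backward linear map
  obtain ⟨lam, hlam⟩ := exists_pageLift D bX hc hfree
  obtain ⟨A, hA⟩ := seam_shadowLinear D bX Ψ hc hfree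
  have hFp : Continuous fun b : ↥(page g c) => Finv b.1 :=
    hFinv.comp_continuous continuous_subtype_val fun b => hpageV b.1 b.2
  obtain ⟨A', hA'⟩ := exists_shadowLinear_of_continuous hc (fun b : ↥(page g c) => Finv b.1) hFp
  -- boundary bookkeeping
  have hbdry : ∀ {x : Base g}, x ∈ (𝓡∂ 4).boundary (Base g) ↔ rho g x.1 = 1 / 4 := fun {x} =>
    RegularSublevel.mem_boundary_iff (isRegularLevel_rho g) x
  -- (1) `A' ∘ A = id`
  have h1 : ∀ v, A' (A v) = v := by
    intro v
    obtain ⟨L, hL, hLp, hLv⟩ := exists_pageLoop_shadow_eq g hc v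
    -- the pushed loop `P = F ∘ L`
    have hP : Continuous fun θ => ((bBase g).incl (Ψ (lam ⟨L θ, hLp θ⟩)) : Base g) :=
      (continuous_pagePush D bX Ψ hfree hlam).comp (hL.subtype_mk hLp)
    have hPA : shadow g (fun θ => ((bBase g).incl (Ψ (lam ⟨L θ, hLp θ⟩)) : Base g)) hP = A v := by
      rw [← hLv]; exact hA L hL (fun θ => hfree _ (hLp θ)) hLp _ (fun θ => hlam ⟨L θ, hLp θ⟩) hP
    have hPF : ∀ θ, F (L θ) = (bBase g).incl (Ψ (lam ⟨L θ, hLp θ⟩)) := fun θ =>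
      hnode (L θ) (hfree _ (hLp θ)) _ (hlam ⟨L θ, hLp θ⟩)
    have hLU : ∀ θ, L θ ∈ {a : Base g | a ∈ (𝓡∂ 4).boundary (Base g) ∧ a ∈ coresComplement h} :=
      fun θ => ⟨page_subset_boundary g hc (hLp θ), hfree _ (hLp θ)⟩
    have hPray : ∀ θ, ∃ r : ℝ, 0 < r ∧
        w g ((bBase g).incl (Ψ (lam ⟨L θ, hLp θ⟩)) : Base g).1 = (r : ℂ) * c := fun θ => by
      obtain ⟨r, hr, hw⟩ := hangle (L θ) (hLU θ)
      rw [hPF] at hw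
      exact ⟨r * (1 / 2), by positivity, by rw [hw, (hLp θ).2]; push_cast; ring⟩
    have hPρ : ∀ θ, rho g ((bBase g).incl (Ψ (lam ⟨L θ, hLp θ⟩)) : Base g).1 = 1 / 4 := fun θ =>
      hbdry.1 ((bBase g).incl_mem_boundary _)
    -- margin and straightening
    obtain ⟨m, hm, hmw⟩ := exists_margin₁
      (fun θ => ‖w g ((bBase g).incl (Ψ (lam ⟨L θ, hLp θ⟩)) : Base g).1‖)
      (((contDiff_w g).continuous.comp (continuous_subtype_val.comp hP)).norm) fun θ => by
        obtain ⟨r, hr, hw⟩ := hPray θ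
        show 0 < ‖w g ((bBase g).incl (Ψ (lam ⟨L θ, hLp θ⟩)) : Base g).1‖
        rw [hw, norm_mul, Complex.norm_real, Real.norm_eq_abs, abs_of_pos hr, hc, mul_one]; exact hr
    obtain ⟨R, θf, -, -, -, hRθ, hρθ, hdirθ, -, -, -, -, -, -, hflat⟩ := helper_strFlow_page g m hm
    have hRρ : ∀ (t : ℝ) (x : Base g), rho g (R.toFun t x).1 = rho g x.1 := fun t x => by rw [hRθ, hρθ]
    have hRdir : ∀ (t : ℝ) (x : Base g), ∃ r : ℝ, 0 < r ∧ w g (R.toFun t x).1 = (r : ℂ) * w g x.1 :=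
      fun t x => by rw [hRθ]; exact hdirθ t x.1
    have hK'p : ∀ θ, R.toFun 1 ((bBase g).incl (Ψ (lam ⟨L θ, hLp θ⟩))) ∈ page g c := fun θ =>
      hflat _ c hc (hPρ θ) (hmw θ) (hPray θ)
    have hK'c : Continuous fun θ => R.toFun 1 ((bBase g).incl (Ψ (lam ⟨L θ, hLp θ⟩))) :=
      (R.contMDiff_toFun 1).continuous.comp hP
    have hK'A : shadow g (fun θ => R.toFun 1 ((bBase g).incl (Ψ (lam ⟨L θ, hLp θ⟩)))) hK'c = A v := by
      rw [← hPA]; exact shadow_comp_ambientIsotopy R 1 hP hK'c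
    -- the stages of `R` applied to the pushed loop stay in `V`
    have hRV : ∀ (t : ℝ) θ, R.toFun t ((bBase g).incl (Ψ (lam ⟨L θ, hLp θ⟩))) ∈ V := by
      intro t θ
      refine hrayV _ c hc hcrit (hbdry.2 (by rw [hRρ, hPρ])) ?_
      obtain ⟨r, hr, hw⟩ := hRdir t ((bBase g).incl (Ψ (lam ⟨L θ, hLp θ⟩)))
      obtain ⟨r', hr', hw'⟩ := hPray θ
      exact ⟨r * r', mul_pos hr hr', by rw [hw, hw']; push_cast; ring⟩
    -- the homotopy `t ↦ F⁻¹ ∘ R_t ∘ F ∘ L` from `L` to `F⁻¹ ∘ K'`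
    have hfam := shadow_eq_of_family (K₀ := L) (K₁ := fun θ => Finv (R.toFun 1 ((bBase g).incl
        (Ψ (lam ⟨L θ, hLp θ⟩)))))
      (fun t θ => Finv (R.toFun t ((bBase g).incl (Ψ (lam ⟨L θ, hLp θ⟩))))) ?_ hL
      (hFp.comp (hK'c.subtype_mk hK'p)) (fun θ => ?_) (fun θ => rfl)
    · rw [← hK'A, ← hA' _ hK'c hK'p, ← hfam]
      exact hLv
    · have hin : Continuous fun p : ℝ × sphere (0 : EuclideanSpace ℝ (Fin 2)) 1 =>
          R.toFun p.1 ((bBase g).incl (Ψ (lam ⟨L p.2, hLp p.2⟩))) :=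
        R.contMDiff.continuous.comp (continuous_fst.prodMk (hP.comp continuous_snd))
      exact hFinv.comp hin.continuousOn fun p _ => hRV p.1 p.2
    · show Finv (R.toFun 0 ((bBase g).incl (Ψ (lam ⟨L θ, hLp θ⟩)))) = L θ
      rw [R.map_zero, id, ← hPF, hleft _ (hLU θ)]
  -- (2) `A ∘ A' = id`
  have h2 : ∀ v, A (A' v) = v := by
    intro v
    obtain ⟨L, hL, hLp, hLv⟩ := exists_pageLoop_shadow_eq g hc v
    -- the pulled-back loop `Q = F⁻¹ ∘ L`
    have hQ : Continuous fun θ => Finv (L θ) := hFp.comp (hL.subtype_mk hLp)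
    have hQA : shadow g (fun θ => Finv (L θ)) hQ = A' v := by rw [← hLv]; exact hA' L hL hLp
    have hQU : ∀ θ, Finv (L θ) ∈ {a : Base g | a ∈ (𝓡∂ 4).boundary (Base g) ∧ a ∈ coresComplement h} :=
      fun θ => hFinvU _ (hpageV _ (hLp θ))
    have hQray : ∀ θ, ∃ r : ℝ, 0 < r ∧ w g (Finv (L θ)).1 = (r : ℂ) * c := fun θ => by
      obtain ⟨r, hr, hw⟩ := hangle (Finv (L θ)) (hQU θ)
      rw [hright _ (hpageV _ (hLp θ)), (hLp θ).2] at hw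
      refine ⟨r⁻¹ * (1 / 2), by positivity, ?_⟩
      have hr0 : (r : ℂ) ≠ 0 := Complex.ofReal_ne_zero.2 hr.ne'
      calc w g (Finv (L θ)).1 = (r : ℂ)⁻¹ * ((r : ℂ) * w g (Finv (L θ)).1) := by
            rw [← mul_assoc, inv_mul_cancel₀ hr0, one_mul]
        _ = (r : ℂ)⁻¹ * (c / 2) := by rw [← hw]
        _ = ((r⁻¹ * (1 / 2) : ℝ) : ℂ) * c := by push_cast; ring
    have hQρ : ∀ θ, rho g (Finv (L θ)).1 = 1 / 4 := fun θ => hbdry.1 (hQU θ).1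
    obtain ⟨m, hm, hmw⟩ := exists_margin₁ (fun θ => ‖w g (Finv (L θ)).1‖)
      (((contDiff_w g).continuous.comp (continuous_subtype_val.comp hQ)).norm) fun θ => by
        obtain ⟨r, hr, hw⟩ := hQray θ
        show 0 < ‖w g (Finv (L θ)).1‖
        rw [hw, norm_mul, Complex.norm_real, Real.norm_eq_abs, abs_of_pos hr, hc, mul_one]; exact hr
    obtain ⟨R, θf, -, -, -, hRθ, hρθ, hdirθ, -, -, -, -, -, -, hflat⟩ := helper_strFlow_page g m hm
    have hRρ : ∀ (t : ℝ) (x : Base g), rho g (R.toFun t x).1 = rho g x.1 := fun t x => by rw [hRθ, hρθ]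
    have hRdir : ∀ (t : ℝ) (x : Base g), ∃ r : ℝ, 0 < r ∧ w g (R.toFun t x).1 = (r : ℂ) * w g x.1 :=
      fun t x => by rw [hRθ]; exact hdirθ t x.1
    have hK''p : ∀ θ, R.toFun 1 (Finv (L θ)) ∈ page g c := fun θ =>
      hflat _ c hc (hQρ θ) (hmw θ) (hQray θ)
    have hK''c : Continuous fun θ => R.toFun 1 (Finv (L θ)) := (R.contMDiff_toFun 1).continuous.comp hQ
    have hK''A : shadow g (fun θ => R.toFun 1 (Finv (L θ))) hK''c = A' v := by
      rw [← hQA]; exact shadow_comp_ambientIsotopy R 1 hQ hK''c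
    -- push `K''` forward: lifts and the forward linear map
    have hPc : Continuous fun θ => ((bBase g).incl (Ψ (lam ⟨R.toFun 1 (Finv (L θ)), hK''p θ⟩)) : Base g) :=
      (continuous_pagePush D bX Ψ hfree hlam).comp (hK''c.subtype_mk hK''p)
    have hPA : shadow g (fun θ => ((bBase g).incl (Ψ (lam ⟨R.toFun 1 (Finv (L θ)), hK''p θ⟩)) : Base g))
        hPc = A (A' v) := by
      rw [← hK''A]
      exact hA _ hK''c (fun θ => hfree _ (hK''p θ)) hK''p _ (fun θ => hlam ⟨_, hK''p θ⟩) hPc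
    -- the stages `R_t (F⁻¹ (L θ))` stay in `U = ∂B ∖ cores`
    have hRU : ∀ (t : ℝ) θ, R.toFun t (Finv (L θ)) ∈
        {a : Base g | a ∈ (𝓡∂ 4).boundary (Base g) ∧ a ∈ coresComplement h} := by
      intro t θ
      refine ⟨hbdry.2 (by rw [hRρ, hQρ]), mem_coresComplement_of_ray hlink hc hcrit ?_⟩
      obtain ⟨r, hr, hw⟩ := hRdir t (Finv (L θ))
      obtain ⟨r', hr', hw'⟩ := hQray θ
      exact ⟨r * r', mul_pos hr hr', by rw [hw, hw']; push_cast; ring⟩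
    -- the homotopy `t ↦ F ∘ R_t ∘ F⁻¹ ∘ L` from `L` to the push of `K''`
    have hfam := shadow_eq_of_family (K₀ := L)
      (K₁ := fun θ => ((bBase g).incl (Ψ (lam ⟨R.toFun 1 (Finv (L θ)), hK''p θ⟩)) : Base g))
      (fun t θ => F (R.toFun t (Finv (L θ)))) ?_ hL hPc (fun θ => ?_) (fun θ => ?_)
    · rw [← hPA, ← hfam]
      exact hLv
    · have hin : Continuous fun p : ℝ × sphere (0 : EuclideanSpace ℝ (Fin 2)) 1 =>
          R.toFun p.1 (Finv (L p.2)) :=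
        R.contMDiff.continuous.comp (continuous_fst.prodMk (hQ.comp continuous_snd))
      exact hF.comp hin.continuousOn fun p _ => hRU p.1 p.2
    · show F (R.toFun 0 (Finv (L θ))) = L θ
      rw [R.map_zero, id, hright _ (hpageV _ (hLp θ))]
    · show F (R.toFun 1 (Finv (L θ))) = (bBase g).incl (Ψ (lam ⟨R.toFun 1 (Finv (L θ)), hK''p θ⟩))
      exact hnode _ (hfree _ (hK''p θ)) _ (hlam ⟨_, hK''p θ⟩)
  -- the automorphism
  refine ⟨LinearEquiv.ofLinear A A' (LinearMap.ext h2) (LinearMap.ext h1), fun K hKc hK hKp z hz hGz => ?_⟩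
  exact hA K hKc hK hKp z hz hGz

/-- **Sub-goal `helper_seam_shadowEquiv` of stub `stub_steinRealisation`** (NF6 ▸ T3 ▸ T3c-2 ▸ ST3, brick
ST3b; wave 4, lead c5): for a fibred model (Lefschetz link `h` of word `l`, data `D`, boundary datum
`bX`, seam `Ψ`, page clause) and a unit direction `c` different from all `pageDir |l| k`, the shadow
transport of the seam on the page `page g c` is an AUTOMORPHISM `A : ℤ^{2g} ≃ₗ[ℤ] ℤ^{2g}`:
`shadow (θ ↦ (bBase g).incl (Ψ (z θ))) = A (shadow K)` for every page loop `K` with lifts `z`.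
[cite: Baykur2006, Thm. 5.1 (proof, p. 13)] -/
theorem helper_seam_shadowEquiv : ∀ (g : ℕ) (l : List ((Fin g ⊕ Fin g → ℤ) × Bool)) (h : Fin l.length → Literature.Topology.FourManifolds.HandleAttachingMap 3 2 (Literature.Topology.FourManifolds.LefschetzBase.Base g)) (X : Type) [TopologicalSpace X] [T2Space X] [SecondCountableTopology X] [CompactSpace X] [ChartedSpace (EuclideanHalfSpace 4) X] [IsManifold (𝓡∂ 4) ∞ X] (D : Literature.Topology.FourManifolds.HandleAttachingMap.MultiAttachmentData h (𝓡∂ 4) X) (bX : Literature.Topology.FourManifolds.BoundaryData (𝓡∂ 4) X (𝓡 3)) (Ψ : bX.carrier ≃ₘ⟮𝓡 3, 𝓡 3⟯ (Literature.Topology.FourManifolds.LefschetzBase.bBase g).carrier), Literature.Topology.FourManifolds.LefschetzBase.IsLefschetzLink g l h → (∀ (y : bX.carrier) (a : ↥(Literature.Topology.FourManifolds.HandleAttachingMap.coresComplement h)), bX.incl y = D.jA a → ∃ c : ℝ, 0 < c ∧ Literature.Topology.FourManifolds.LefschetzBase.w g ((Literature.Topology.FourManifolds.LefschetzBase.bBase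 g).incl (Ψ y)).1 = (c : ℂ) * Literature.Topology.FourManifolds.LefschetzBase.w g (a : Literature.Topology.FourManifolds.LefschetzBase.Base g).1) → ∀ (c : ℂ), ‖c‖ = 1 → (∀ k : Fin l.length, c ≠ Literature.Topology.FourManifolds.LefschetzBase.pageDir l.length k) → ∃ A : (Fin g ⊕ Fin g → ℤ) ≃ₗ[ℤ] (Fin g ⊕ Fin g → ℤ), ∀ (K : Metric.sphere (0 : EuclideanSpace ℝ (Fin 2)) 1 → Literature.Topology.FourManifolds.LefschetzBase.Base g) (hKc : Continuous K) (hK : ∀ θ, K θ ∈ Literature.Topology.FourManifolds.HandleAttachingMap.coresComplement h), (∀ θ, K θ ∈ Literature.Topology.FourManifolds.LefschetzBase.page g c) → ∀ (z : Metric.sphere (0 : EuclideanSpace ℝ (Fin 2)) 1 → bX.carrier), (∀ θ, bX.incl (z θ) = D.jA ⟨K θ, hK θ⟩) → ∀ (hGz : Continuous fun θ => ((Literature.Topology.FourManifolds.LefschetzBase.bBase g).incl (Ψ (z θ)) : Literature.Topology.FourManifolds.LefschetzBase.Base g)), Literature.Topology.FourManifolds.LefschetzBase.shadow g (fun θ =>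 ((Literature.Topology.FourManifolds.LefschetzBase.bBase g).incl (Ψ (z θ)) : Literature.Topology.FourManifolds.LefschetzBase.Base g)) hGz = A (Literature.Topology.FourManifolds.LefschetzBase.shadow g K hKc) :=
  fun _ _ _ _ _ _ _ _ _ _ D bX Ψ hlink hpage _ hc hcrit => seam_shadowEquiv D bX Ψ hlink hpage hc hcrit

end Equiv

end Summit.SmoothPoincare4.SmoothPoincare4.Theorems.AcyclicBisectionExists.ModpBraidOrbits

end
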